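import Literature.NumberTheory.EllipticCurves.Kato2004.MainConjecturePrimeTDoor
import Literature.NumberTheory.EllipticCurves.Kato2004.AdmissibleZetaClassNonvanishingProofs
import Summits.BirchSwinnertonDyer.BirchSwinnertonDyer.Theorems.CyclotomicUntwistRohrlichAtLevel
import HarnessLib

/-!
# Route `DerivedKatoValuationDoor`, crux `DerivedKatoDoor` (stmt-BirchSwinnertonDyer-23024), line `lower`
# (skeleton `Cruxes/DerivedKatoDoor/Lines/lower.lean`, sha16 ebb799eaeb28): registered stub
# `stub_quotientLengthLeFineLength` («at a door prime every admissible Kato zeta class `z₀` is non-zero and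
# `ℓ_T(𝐇¹/Λz₀) ≤ ℓ_T(X₀(E/ℚ_∞))`») — the non-vanishing PROVED unconditionally, the inequality REDUCED,
# kernel-checked, to ONE print fact (Kato Conj. 12.10 at `(T)`, a theorem at door primes by
# Burungale–Castella–Skinner 2025 + Kato §17.13: `Literature/…/Kato2004/MainConjecturePrimeTDoor.lean`)
# (stub worker `bsd-line-dkd-w2`; `--supports stmt-BirchSwinnertonDyer-23024`; namespace
# `…Theorems.DerivedKatoValuationDoor`)

WHAT.
* `isAdmissibleZetaClass_ne_zero` — UNCONDITIONAL: an admissible Kato zeta class `z₀ ∈ 𝐇¹_Γ(T_pW)`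
  (`Kato2004.IsAdmissibleZetaClass`, any `W/ℚ` globally minimal, any prime `p`, any cyclotomic `K` with
  topological generator `γ`) is `≠ 0`. Kato Thm. 12.5 via Rohrlich: the tree's
  `IsAdmissibleZetaClass.ne_zero_of_rohrlich` fed with the Summits-side THEOREM
  `PSRohrlichAtLevel.rohrlich_primePow_of_isNewformOf` (Rohrlich 1984 for the newform of `W` at EVERY `p`,
  proved in tree) and the `ℤ_p`-structure theorems `module_free_tateModule_holds` /
  `module_finite_tateModule_holds`. This is conjunct 1 of the stub, closed outright.
* `stub_quotientLengthLeFineLength_of_fact` — CONDITIONAL on the Literature named fact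
  `Kato2004.kato_mainConjecture_primeT_of_door` (Kato Conj. 12.10 at `𝔭 = (T)` for `T_pW` at door primes,
  on Kato's `𝐇²_Γ` with its Poitou–Tate embedding `X₀ ↪ 𝐇²_Γ` of finite cokernel, through admissible
  classes): the registered signature of `stub_quotientLengthLeFineLength` VERBATIM. Proof: `ℓ_T(X₀) =
  ℓ_T(𝐇²_Γ)` (injective with finite cokernel at the height-one prime `(T)`:
  `lengthAt_eq_of_injective_of_finite_quotient`, `IwasawaAlgebra.height_primeT`) `= ℓ_T(𝐇¹/Λz₀)` (the fact),
  so `≤` holds with equality; conjunct 1 by the unconditional lemma.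

HONEST FRAMING. The inequality is NOT closed unconditionally here: its one hypothesis is an unproved
Literature named fact (D-0014; size XL — it packages BCS's cyclotomic IMC and Kato's §17.13 translation;
discharge road recorded in that file's docstring). The lead may reshape the skeleton to carry the fact as
the line's print stub («closed modulo `kato_mainConjecture_primeT_of_door`»). The crux additionally needs
the OPEN stub `stub_fineLengthLeOneOfAnalyticRankTwo`. BSD is not proved by any of this.

References: K. Kato, Astérisque 295 (2004), Conj. 12.10 (p. 224), Thm. 12.5 (pp. 221–222), §17.13
(pp. 279–280), (14.9.1) (p. 239) [Kato2004Asterisque]; A. Burungale, F. Castella, C. Skinner, IMRN 2025,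
Thm. 1.1.2 (a) [BurungaleCastellaSkinner2025]; D. Rohrlich, Invent. Math. 75 (1984), Theorem p. 409
[RohrlichInventiones1984]; H. Imai, Proc. Japan Acad. 51 (1975) [Imai1975].
-/

-- D-0017: single-problem summit, so `Summit.BirchSwinnertonDyer.BirchSwinnertonDyer.…` repeats a
-- namespace BY DESIGN.
set_option linter.dupNamespace false

noncomputable section

open scoped Classical

namespace Summit.BirchSwinnertonDyer.BirchSwinnertonDyer.Theorems.DerivedKatoValuationDoor

open Field CongruenceSubgroup
open Literature.NumberTheory.GaloisRepresentations
open Literature.NumberTheory.EllipticCurves Literature.NumberTheory.EllipticCurves.ModularForms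
open Literature.NumberTheory.EllipticCurves.Module
open Literature.NumberTheory.EllipticCurves.Kato2004
open Summit.BirchSwinnertonDyer.BirchSwinnertonDyer.Theorems.PSRohrlichAtLevel (rohrlich_primePow_of_isNewformOf)

/-- **An admissible Kato zeta class is non-zero — unconditionally (conjunct 1 of
`stub_quotientLengthLeFineLength`).** For `W/ℚ` globally minimal elliptic, any prime `p`, a cyclotomic
`ℤ_p`-extension `K` with topological generator `γ`, a pinned `I : IwasawaH1Data W p K γ` and
`z₀ ∈ I.H` admissible: `z₀ ≠ 0`. Kato's proof of Thm. 12.5 from Thm. 12.4 via Rohrlich («`L(f,χ,1) ≠ 0`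
for almost all characters `χ` of `Gal(ℚ(ζ_{p^∞})/ℚ)` ⇒ the zeta element is not zero»): the tree theorem
`IsAdmissibleZetaClass.ne_zero_of_rohrlich` with its Rohrlich hypothesis DISCHARGED for every `p` by the
Summits-side theorem `PSRohrlichAtLevel.rohrlich_primePow_of_isNewformOf`, and the `ℤ_p`-structure of
`T_pW` by `module_free_tateModule_holds` / `module_finite_tateModule_holds`.
[cite: Kato2004Asterisque, Thm. 12.5 (1) and its proof (pp. 221–222)]
[cite: RohrlichInventiones1984, Theorem (p. 409)] -/
theorem isAdmissibleZetaClass_ne_zero {W : WeierstrassCurve ℚ} [W.IsElliptic] [W.IsGloballyMinimal]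
    {p : ℕ} [Fact p.Prime] [ContinuousSMul ℤ_[p] (W.tateModule p)] {K : ZpExtension ℚ p}
    {hK : K.IsCyclotomic} {γ : absoluteGaloisGroup ℚ} {I : IwasawaH1Data W p K γ} {z₀ : I.H}
    (hz : IsAdmissibleZetaClass W p K hK I z₀) (hγ : K.IsTopGenerator γ) : z₀ ≠ 0 := by
  letI : Module.Free ℤ_[p] (W.tateModule p) := W.module_free_tateModule_holds p
  letI : Module.Finite ℤ_[p] (W.tateModule p) := W.module_finite_tateModule_holds p
  exact hz.ne_zero_of_rohrlich hγ fun hf => rohrlich_primePow_of_isNewformOf hf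

/-- **Stub `stub_quotientLengthLeFineLength` of line `lower` (crux `DerivedKatoDoor`,
stmt-BirchSwinnertonDyer-23024), REDUCED TO PRINT: ASSUMING the Literature named fact
`Kato2004.kato_mainConjecture_primeT_of_door` (Kato Conj. 12.10 at `𝔭 = (T)` for `T_pW` at door primes — a
theorem there by Burungale–Castella–Skinner 2025 Thm. 1.1.2 (a) + Kato §17.13 — on Kato's `𝐇²_Γ(T_pW)` with
its Poitou–Tate embedding of `X₀(E/ℚ_∞)` of finite cokernel, Kato (14.9.1) + Imai), the registered signature
holds VERBATIM: at a door prime (`5 ≤ p`, good ordinary, `ρ̄_{E,p}` onto), for every cyclotomic `K`,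
topological generator `γ`, pinned `I` and ADMISSIBLE `z₀ ∈ I.H`: `z₀ ≠ 0` (unconditional,
`isAdmissibleZetaClass_ne_zero`) and `ℓ_T(I.H/Λz₀) ≤ ℓ_T((W.fineSelmerDualData K hγ).X)` — indeed `=`:
`ℓ_T(X₀) = ℓ_T(J.H2)` (`lengthAt_eq_of_injective_of_finite_quotient` at the height-one prime `(T)`,
`IwasawaAlgebra.height_primeT`) `= ℓ_T(I.H/Λz₀)` (the fact). CONDITIONAL on the named fact (unproved, D-0014).
[cite: Kato2004Asterisque, Conj. 12.10 (p. 224), §17.13 (pp. 279–280), (14.9.1) (p. 239)]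
[cite: BurungaleCastellaSkinner2025, Thm. 1.1.2 (a)] [cite: Imai1975, Theorem (p. 12)] -/
theorem stub_quotientLengthLeFineLength_of_fact (hMC : kato_mainConjecture_primeT_of_door) :
    ∀ (W : WeierstrassCurve ℚ) [W.IsElliptic] [W.IsGloballyMinimal] (p : ℕ) [Fact p.Prime]
      [ContinuousSMul ℤ_[p] (W.tateModule p)],
      (5 ≤ p ∧ Literature.NumberTheory.EllipticCurves.IsOrdinaryAt W p ∧ W.HasSurjectiveModNGaloisRep p) →
      ∀ (K : Literature.NumberTheory.EllipticCurves.ZpExtension ℚ p) (hK : K.IsCyclotomic)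
        (γ : Field.absoluteGaloisGroup ℚ)
        (I : Literature.NumberTheory.EllipticCurves.Kato2004.IwasawaH1Data W p K γ) (z₀ : I.H)
        (hγ : K.IsTopGenerator γ),
        Literature.NumberTheory.EllipticCurves.Kato2004.IsAdmissibleZetaClass W p K hK I z₀ →
        z₀ ≠ 0 ∧
          Literature.NumberTheory.EllipticCurves.Module.lengthAt
              (Literature.NumberTheory.EllipticCurves.IwasawaAlgebra p)
              (I.H ⧸ Submodule.span (Literature.NumberTheory.EllipticCurves.IwasawaAlgebra p) {z₀})
              (Literature.NumberTheory.EllipticCurves.IwasawaAlgebra.primeT p) ≤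
            Literature.NumberTheory.EllipticCurves.Module.lengthAt
              (Literature.NumberTheory.EllipticCurves.IwasawaAlgebra p)
              (W.fineSelmerDualData K hγ).X
              (Literature.NumberTheory.EllipticCurves.IwasawaAlgebra.primeT p) := by
  intro W _ _ p _ _ hdoor K hK γ I z₀ hγ hz
  obtain ⟨h5, hord, hsurj⟩ := hdoor
  refine ⟨isAdmissibleZetaClass_ne_zero hz hγ, ?_⟩
  obtain ⟨J, e, he, hfin, hlen⟩ := hMC W p h5 hord hsurj K hK γ hγ I
  -- `ℓ_T(X₀) = ℓ_T(𝐇²)` (injective with finite cokernel; `(T)` has height one)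
  have hX : lengthAt (IwasawaAlgebra p) (W.fineSelmerDualData K hγ).X (IwasawaAlgebra.primeT p) =
      lengthAt (IwasawaAlgebra p) J.H2 (IwasawaAlgebra.primeT p) :=
    lengthAt_eq_of_injective_of_finite_quotient e he hfin (IwasawaAlgebra.primeT p)
      (IwasawaAlgebra.height_primeT p).le
  -- `ℓ_T(𝐇²) = ℓ_T(𝐇¹/Λz₀)` (Conj. 12.10 at `(T)`)
  rw [hX, hlen z₀ hz]

end Summit.BirchSwinnertonDyer.BirchSwinnertonDyer.Theorems.DerivedKatoValuationDoor

end
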